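import Summits.QuantumFields.BalabanUV.Beta.D1BFx.CrossERestLists
import Summits.QuantumFields.BalabanUV.Beta.D1BFx.SplitPackaged
import Summits.QuantumFields.BalabanUV.Beta.D1BFx.DegreeSevenCount
import Summits.QuantumFields.BalabanUV.Beta.D1BFx.ContactCount

/-!
# `BalabanUV.Beta.D1BFx.CrossERest` — road «BF-x» for binder row D1, slot (REST), the `RestIdx` member `crossE` (part 2 of 2): THE EXACT RE-CUT
# `restK_crossE = lonK + remK` (three grade-2 LONGITUDINAL words, displayed for A3.a's `SbR_loc` cancellation + five grade-≥3 REMAINDER words), AND THE A2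
# BOUND `|fullSum remK| ≤ |ω_gl·cE²|·n⁻⁸·80·A` — leaf-07's quintic count on an3's `IsO 7` decay, at every block size and base site whose frozen profile is a
# member of ONE leg family with the difference budget `DG 3 2`; (CONV) for both pieces; the packaged binders against `SplitPackaged.KrPk`

HONEST DEPENDENCY (page 1, mandatory): continuum YM on T⁴ ⇐ BetaPertH ∧ nine spine estimates (0/9 proved); BetaPertH ⇐ (D1) ∧ (D4) ∧
CAP+tail; G-an2-4 gates asym, D1 and NE2/3/4.  HONEST FRAMING (cell contract, verbatim): «discharging `BetaPertH` makes Bałaban's UV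
stability UNCONDITIONAL — a real constructive-QFT result; it is NOT the continuum limit and NOT the Clay problem.»  THIS MODULE DISCHARGES
NOTHING of the wall: TWO definitions with bodies ([our objects] the integrands `lonK`, `remK` of the two halves of the crossE word) and [folklore]
bookkeeping BY NAME over part 1 (`CrossERestLists`), the owner's bridge `FineHessianLegGrades.bubble_frozenLeg_realK_realK` ∕ `ModelTablesRealised.bub_reixStn`,
`SplitInstance.restK_crossE`, `SplitPackaged.KrPk`, leaf-07's A2 count `DegreeSevenCount.abs_fullSum_le_of_quintic` ∕ `exists_tendsto_psum_of_quintic`, an2's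
`DecimatedMomentSummable.absMoment₂_of_decay510`, the owner's `Assembly.exists_tendsto_psum_weight_mul` ∕ `sum_uniform_resSite` and leaf-09's
`ContactCount.abs_sum_mul_le_of_convex`.  No `Prop` minted, nothing cited, no printed statement as hypothesis, 0 sorry.  The profile `g`, the weights, the leg
family `G` are ARBITRARY: nothing about Bałaban's propagators is asserted.  0 wall binders; NOT the (K) slot, NOT A3.a, NOT D1, NOT `BetaPertH`, NOT
continuum, NOT Clay.

ABSOLUTE RULE (cell charter, verbatim): «No internally-minted statement may enter as a cited fact. Every hypothesis is either kernel-proved in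
this package or a verbatim quotation of a PUBLISHED theorem with page reference. The manuscript(s) under audit are NOT citable for their own
disputed steps — they are the thing under adjudication; programme-internal (2001/route/tribunal) claims are never citable.»

WHY (owner d1-p2-g2, `SPLIT-SPEC.md` v1.1 §3 (τ-E1) «`VEC × REMₐ`, `REMₐ × VEC`, `REMₐ × REMₐ` over `A_b ⊗ A_b` — degree ≥ 7 → A2 `DegreeSevenCount`», (τ-E2) «the
`(cE•DIVₐ + cR•SbR_loc)` cross terms VANISH IDENTICALLY by the definition of `SbR_loc`»; §4 «A2: … via `restK_crossE` + `SbE_split`»; journal l.15231).  Part 1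
wrote the road's E-sector stencil as ONE graded list and split an3's bubble difference into `lonW` (grade 2) + `remW` (grade ≥ 3, `IsO 7` under `DG 3 2`).
THIS PART returns to the road's currency.  Over the frozen leg the crossE word at base site `b`, displacement `w`, is an3's table at relative position
`−w` (the owner's bridge, base points `b + w` and `b = (b + w) + (−w)`); it does not see `b` except through the profile `g`.  So
`restK_crossE = lonK + remK` EXACTLY, with `lonK`∕`remK` the weighted (1.22)-integrands of `lonW`∕`remW` — and the A2 count applies to `remK`: an `IsO 7`
table times `w_μw_ν` is QUINTIC shellwise, its punctured full sum is `≤ 160·C` (leaf-07), uniformly in everything but the decay constant `A`.  The constant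
is uniform over ALL block sizes and base sites exactly when all frozen profiles `gp n b` are members of ONE `(L,k)`-family `G` with `DG 3 2 G` (`gp n b = G n
(e b)`): this is the DISPLAYED leg hypothesis — rows d0–d3 of the frozen gluon profile uniform in base point and block size, ONE difference more than the END's
h∕d 0–2 rows; (α)-leaf content, NOT in the tree, NOT asserted.  The n-uniformity in the weights is the displayed inequality `|ω_gl n·cE n²|·n⁻⁸ ≤ Ω`
(slot (K) ∕ CHECK-N0).  `lonK` is NOT bounded here (it is `IsO 6`: log-carrying) — it is the A3.a author's to cancel against `SbR_loc`.
* §1 [folklore] `bubble_frozen_reix` (the bridge at base points `b + w`, `b`, with the colourless re-indexing stripped), `crossE_diff_eq` (the bubble difference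
  of `restK_crossE` IS `(lonW + remW) g μ ν 0 0 (−w)`).
* §2 [our objects] `lonK`, `remK`; **`restK_crossE_eq_lonK_add_remK`**; `KrPk_crossE_eq` (the owner's n-packaging, `1 ≤ n`).
* §3 [folklore] THE A2 BOUND at fixed `(n, g)` from an explicit degree-7 constant: `abs_remK_le_quintic` (shellwise), **`abs_fullSum_remK_le`**
  (`≤ |ω_gl·cE²|·n⁻⁸·(80·A)`), `conv_remK_of_decay`.
* §4 [folklore] (CONV) at fixed `n` for BOTH halves from an exponential bound on `g` alone (part 1's envelopes + an2's `absMoment₂_of_decay510`): `conv_lonK`, `conv_remK`,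
  and for the whole word **`conv_restK_crossE`** (= the owner's `AssemblyEnd.defect_le_at` hypothesis `hKr` at `τ = crossE`).
* §5 [folklore] base-point average `abs_avg_fullSum_remK_le`; the packaged statements against `SplitPackaged.KrPk … crossE`: **`hKr_lonK_packaged`**,
  **`hKr_remK_packaged`** ((CONV), from the owner's `hg`), **`hR_remK_packaged`** (∃ A ≥ 0, ∀ n ≥ 2, `|Σ_b n⁻⁴·fullSum (remK n (gp n b) …)| ≤ |ω_gl n·cE n²|·n⁻⁸·80·A`
  from `DG 3 2 G` + membership), `hR_remK_packaged_of_weight` (`≤ Ω·(80·A)` under the displayed weight inequality).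
Unit `b2b-balaban-beta-d1-formalise-leaf-03` (gen 4), D1 formalisation swarm; `LEAVES-BFx.md` row A2 ∕ (REST) (sub-leaf «D1-BFx-REST-crossE», part 2).
-/

noncomputable section

namespace Summit.QuantumFields.BalabanUV.Beta.D1BFx.CrossERest

open Finset Filter Topology
open scoped BigOperators
open Literature.Probability.LatticeModels (annulus)
open Literature.MathematicalPhysics.QuantumFieldTheory.Balaban1983to89
open Literature.MathematicalPhysics.QuantumFieldTheory.Balaban1983to89.Beta
open B12Sec2to5 (l1 l1_nonneg Decay510)
open ExpKernelCalculus (Site MKer bubble l1_sub_symm)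
open DyadicShell (Pt toReal supNorm supNorm_eq_of_mem_sphere ne_zero_of_mem_annulus)
open BubbleTransfer (abs_moment_le)
open WindowIdentification (psum fullSum)
open DecimatedMomentSummable (absMoment₂_of_decay510)
open DressedMomentNormalisation (resSite)
open GradedBubbles (Fam IsO DG Stn bub supNorm_neg)
open Summit.QuantumFields.BalabanUV.Beta.D1BFx.GluonKernelSectors (SbE)
open Summit.QuantumFields.BalabanUV.Beta.D1BFx.StencilRealisation (realK)
open Summit.QuantumFields.BalabanUV.Beta.D1BFx.WilsonStencilRealised (reixStn ιU)
open Summit.QuantumFields.BalabanUV.Beta.D1BFx.ModelTablesRealised (ιUEquiv reixStn_ιU bub_reixStn)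
open Summit.QuantumFields.BalabanUV.Beta.D1BFx.MainTable (vecK)
open Summit.QuantumFields.BalabanUV.Beta.D1BFx.FineHessianLegGrades (frozenLeg bubble_frozenLeg_realK_realK)
open Summit.QuantumFields.BalabanUV.Beta.D1BFx.ReducedKernel (TableR)
open Summit.QuantumFields.BalabanUV.Beta.D1BFx.SplitInstance (RestIdx restK restK_crossE)
open Summit.QuantumFields.BalabanUV.Beta.D1BFx.SplitPackaged (KrPk)
open Summit.QuantumFields.BalabanUV.Beta.D1BFx.Assembly (exists_tendsto_psum_weight_mul exists_tendsto_psum_const_mul sum_uniform_resSite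
  uniform_resSite_nonneg)
open Summit.QuantumFields.BalabanUV.Beta.D1BFx.ContactCount (abs_sum_mul_le_of_convex)
open Summit.QuantumFields.BalabanUV.Beta.D1BFx.DegreeSevenCount (abs_fullSum_le_of_quintic exists_tendsto_psum_of_quintic)
open Summit.QuantumFields.BalabanUV.Beta.D1BFx.CrossERestLists

/-! ## §1 The bridge at base points `b + w`, `b`; the crossE bubble difference is `lonW + remW` at `−w` -/

/-- [folklore] **THE BRIDGE** (owner's `bubble_frozenLeg_realK_realK` + `bub_reixStn`): over the frozen leg, first vertex realised at `b + w`, second at `b`,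
colourless re-indexing stripped: `bubble (frozenLeg g) (realK (b+w) (b+w) (reix X)) (realK b b (reix Y)) = bub g g X Y L k (−w)` (every dummy `L k`). -/
theorem bubble_frozen_reix (g : Pt → ℝ) (X Y : Stn (Unit × Fin 4)) (b w : Pt) (L k : ℕ) :
    bubble (frozenLeg g : MKer 4 (Fin 4)) (realK (b + w) (b + w) (reixStn ιU X)) (realK b b (reixStn ιU Y)) =
      bub (fun _ _ => g) (fun _ _ => g) X Y L k (-w) := by
  have e : realK b b (reixStn ιU Y) = realK (b + w + -w) (b + w + -w) (reixStn ιU Y) := by rw [add_neg_cancel_right]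
  rw [e, bubble_frozenLeg_realK_realK, reixStn_ιU, reixStn_ιU, bub_reixStn]

/-- [folklore] **THE crossE BUBBLE DIFFERENCE IS `lonW + remW` AT `−w`** (part 1's `SbE_eq_realK_lists`, `vecK_eq_realK_vec₀`, `bub_lists_sub_bub_vec₀`). -/
theorem crossE_diff_eq (g : Pt → ℝ) (μ ν : Fin 4) (b w : Pt) :
    bubble (frozenLeg g : MKer 4 (Fin 4)) (SbE μ (b + w)) (SbE ν b) - bubble (frozenLeg g : MKer 4 (Fin 4)) (vecK μ (b + w)) (vecK ν b) =
      lonW (fun _ _ => g) μ ν 0 0 (-w) + remW (fun _ _ => g) μ ν 0 0 (-w) := by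
  rw [SbE_eq_realK_lists, SbE_eq_realK_lists, vecK_eq_realK_vec₀, vecK_eq_realK_vec₀, bubble_frozen_reix g _ _ b w 0 0,
    bubble_frozen_reix g _ _ b w 0 0, ← Pi.add_apply, ← Pi.add_apply, ← Pi.add_apply, ← bub_lists_sub_bub_vec₀]
  rfl

/-! ## §2 The two halves of the crossE word -/

/-- [our object] **THE LONGITUDINAL HALF OF THE crossE WORD** (grade 2 — log-carrying; to be cancelled against `SbR_loc`, A3.a; NOT bounded in this file):
`lonK n g cE ω_gl μ ν w := ω_gl·(cE·cE·(n⁻⁸·(w_μw_ν·(−½·lonW g μ ν 0 0 (−w)))))`.  A DEFINITION; asserts nothing. -/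
def lonK (n : ℕ) (g : Pt → ℝ) (cE ωgl : ℝ) (μ ν : Fin 4) : Pt → ℝ := fun w =>
  ωgl * (cE * cE * (((n : ℝ) ^ 8)⁻¹ * (toReal w μ * toReal w ν * (-(1 / 2 : ℝ) * lonW (fun _ _ => g) μ ν 0 0 (-w)))))

/-- [our object] **THE REMAINDER HALF OF THE crossE WORD** (grade ≥ 3 — the A2 class):
`remK n g cE ω_gl μ ν w := ω_gl·(cE·cE·(n⁻⁸·(w_μw_ν·(−½·remW g μ ν 0 0 (−w)))))`.  A DEFINITION; asserts nothing. -/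
def remK (n : ℕ) (g : Pt → ℝ) (cE ωgl : ℝ) (μ ν : Fin 4) : Pt → ℝ := fun w =>
  ωgl * (cE * cE * (((n : ℝ) ^ 8)⁻¹ * (toReal w μ * toReal w ν * (-(1 / 2 : ℝ) * remW (fun _ _ => g) μ ν 0 0 (-w)))))

section Split

variable (n : ℕ) [NeZero n] (a : ℝ) (g : Pt → ℝ) (cE cΛ cR cK cQ cE₂ cJ4 cΛ₂ cR₂ cQ₂ x₀ : ℝ) (WE WJ WΛ WR WQ : TableR)
  (ωgl ωgh lam N : ℝ) (μ ν : Fin 4) (b : Pt)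

/-- [folklore] **THE EXACT RE-CUT OF THE crossE WORD**: `restK … b crossE = lonK n g cE ω_gl μ ν + remK n g cE ω_gl μ ν` (pointwise; the base site enters only
through the profile `g`). -/
theorem restK_crossE_eq_lonK_add_remK :
    restK n a g cE cΛ cR cK cQ cE₂ cJ4 cΛ₂ cR₂ cQ₂ x₀ WE WJ WΛ WR WQ ωgl ωgh lam N μ ν b (Sum.inr (Sum.inr (Sum.inr (Sum.inr 1)))) =
      lonK n g cE ωgl μ ν + remK n g cE ωgl μ ν := by
  funext w
  rw [restK_crossE, crossE_diff_eq, Pi.add_apply, lonK, remK]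
  ring

end Split

section Packaged

variable (a : ℝ) (gp : ℕ → Pt → Pt → ℝ) (cE cVH cΛ cR cK cQ cE₂ cJ4 cΛ₂ cR₂ cQ₂ x₀ : ℕ → ℝ) (WE WJ WΛ WR WQ : ℕ → TableR)
  (ωgl ωgh lam : ℕ → ℝ) (N : ℝ) (μ ν : Fin 4)

/-- [folklore] The same in the owner's n-packaging (`1 ≤ n`): `KrPk … crossE n b = lonK n (gp n b) (cE n) (ω_gl n) μ ν + remK n (gp n b) (cE n) (ω_gl n) μ ν`. -/
theorem KrPk_crossE_eq {n : ℕ} (h1 : 1 ≤ n) (b : Pt) :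
    KrPk a gp cE cΛ cR cK cQ cE₂ cJ4 cΛ₂ cR₂ cQ₂ x₀ WE WJ WΛ WR WQ ωgl ωgh lam N μ ν (Sum.inr (Sum.inr (Sum.inr (Sum.inr 1)))) n b =
      lonK n (gp n b) (cE n) (ωgl n) μ ν + remK n (gp n b) (cE n) (ωgl n) μ ν := by
  haveI : NeZero n := ⟨Nat.one_le_iff_ne_zero.mp h1⟩
  funext w
  simp only [KrPk, dif_pos h1]
  rw [restK_crossE_eq_lonK_add_remK]

end Packaged

/-! ## §3 The A2 bound for the remainder half from an explicit degree-7 constant -/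

section Bound

variable (n : ℕ) {g : Pt → ℝ} (cE ωgl : ℝ) (μ ν : Fin 4) {A : ℝ}

/-- [folklore] SHELLWISE: a degree-7 decay `|remW g μ ν 0 0 w| ≤ A/‖w‖∞⁷` (`w ≠ 0`) makes `remK` QUINTIC on every shell:
`|remK n g cE ω_gl μ ν w| ≤ (|ω_gl·(cE·cE)|·n⁻⁸·(½·A))/(r+1)⁵` for `‖w‖∞ = r + 1`. -/
theorem abs_remK_le_quintic (hdec : ∀ w : Pt, w ≠ 0 → |remW (fun _ _ => g) μ ν 0 0 w| ≤ A / (supNorm w : ℝ) ^ 7)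
    (r : ℕ) (w : Pt) (hw : w ∈ annulus 4 r (r + 1)) :
    |remK n g cE ωgl μ ν w| ≤ |ωgl * (cE * cE)| * ((n : ℝ) ^ 8)⁻¹ * ((1 / 2 : ℝ) * A) / ((r : ℝ) + 1) ^ 5 := by
  have hw0 : w ≠ 0 := ne_zero_of_mem_annulus hw
  have hs : (supNorm w : ℝ) = (r : ℝ) + 1 := by rw [supNorm_eq_of_mem_sphere hw]; push_cast; ring
  have hr1 : (0 : ℝ) < (r : ℝ) + 1 := by positivity
  have hmom : |toReal w μ * toReal w ν| ≤ ((r : ℝ) + 1) ^ 2 := by rw [← hs]; exact abs_moment_le μ ν w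
  have hrem : |remW (fun _ _ => g) μ ν 0 0 (-w)| ≤ A / ((r : ℝ) + 1) ^ 7 := by
    have h := hdec (-w) (neg_ne_zero.mpr hw0)
    rwa [supNorm_neg, hs] at h
  have e : remK n g cE ωgl μ ν w =
      (ωgl * (cE * cE)) * ((n : ℝ) ^ 8)⁻¹ * (-(1 / 2 : ℝ)) * ((toReal w μ * toReal w ν) * remW (fun _ _ => g) μ ν 0 0 (-w)) := by
    simp only [remK]; ring
  rw [e, abs_mul, abs_mul, abs_mul, abs_mul (toReal w μ * toReal w ν), abs_of_nonneg (by positivity : (0 : ℝ) ≤ ((n : ℝ) ^ 8)⁻¹),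
    show |(-(1 / 2 : ℝ))| = 1 / 2 by norm_num]
  have hn0 : 0 ≤ |ωgl * (cE * cE)| * ((n : ℝ) ^ 8)⁻¹ * (1 / 2 : ℝ) := by positivity
  calc |ωgl * (cE * cE)| * ((n : ℝ) ^ 8)⁻¹ * (1 / 2) * (|toReal w μ * toReal w ν| * |remW (fun _ _ => g) μ ν 0 0 (-w)|)
      ≤ |ωgl * (cE * cE)| * ((n : ℝ) ^ 8)⁻¹ * (1 / 2) * (((r : ℝ) + 1) ^ 2 * (A / ((r : ℝ) + 1) ^ 7)) :=
        mul_le_mul_of_nonneg_left (mul_le_mul hmom hrem (abs_nonneg _) (by positivity)) hn0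
    _ = |ωgl * (cE * cE)| * ((n : ℝ) ^ 8)⁻¹ * ((1 / 2 : ℝ) * A) / ((r : ℝ) + 1) ^ 5 := by
        field_simp

/-- [folklore] **THE A2 BOUND FOR THE REMAINDER HALF** (leaf-07's `abs_fullSum_le_of_quintic`: `Σ_r 80(r+1)³·(r+1)⁻⁵ ≤ 160`): a degree-7 decay of the
remainder word sum with constant `A ≥ 0` gives `|fullSum (remK n g cE ω_gl μ ν)| ≤ |ω_gl·(cE·cE)|·n⁻⁸·(80·A)` — free of everything but `A` and the weights. -/
theorem abs_fullSum_remK_le (hA : 0 ≤ A) (hdec : ∀ w : Pt, w ≠ 0 → |remW (fun _ _ => g) μ ν 0 0 w| ≤ A / (supNorm w : ℝ) ^ 7) :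
    |fullSum (remK n g cE ωgl μ ν)| ≤ |ωgl * (cE * cE)| * ((n : ℝ) ^ 8)⁻¹ * (80 * A) := by
  have h := abs_fullSum_le_of_quintic (K := remK n g cE ωgl μ ν) (C := |ωgl * (cE * cE)| * ((n : ℝ) ^ 8)⁻¹ * ((1 / 2 : ℝ) * A))
    (by positivity) (fun r w hw => abs_remK_le_quintic n cE ωgl μ ν hdec r w hw)
  refine h.trans (le_of_eq ?_)
  ring

/-- [folklore] (CONV) for the remainder half from the degree-7 decay (leaf-07's `exists_tendsto_psum_of_quintic`). -/
theorem conv_remK_of_decay (hA : 0 ≤ A) (hdec : ∀ w : Pt, w ≠ 0 → |remW (fun _ _ => g) μ ν 0 0 w| ≤ A / (supNorm w : ℝ) ^ 7) :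
    ∃ B, Tendsto (psum (remK n g cE ωgl μ ν)) atTop (𝓝 B) :=
  exists_tendsto_psum_of_quintic (C := |ωgl * (cE * cE)| * ((n : ℝ) ^ 8)⁻¹ * ((1 / 2 : ℝ) * A)) (by positivity)
    (fun r w hw => abs_remK_le_quintic n cE ωgl μ ν hdec r w hw)

end Bound

/-! ## §4 (CONV) at a fixed block size for both halves, from an exponential bound on the profile alone -/

section Conv

variable (n : ℕ) {g : Pt → ℝ} (cE ωgl : ℝ) (μ ν : Fin 4) {C δ : ℝ}

/-- [folklore] `|v|₁` is even. -/
theorem l1_neg' (w : Pt) : l1 (-w) = l1 w := by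
  have h := l1_sub_symm (0 : Pt) w
  rwa [zero_sub, sub_zero] at h

/-- [folklore] An exponentially enveloped `(L,k)`-family, reflected, is a (5.10)-kernel; its (1.22)-weighted integrand with any scalar prefactor has convergent
punctured partial sums (an2's `absMoment₂_of_decay510` + the owner's `exists_tendsto_psum_weight_mul`). -/
theorem conv_of_envelope {F : Fam} (hδ : 0 < δ) (hF : ∃ C' : ℝ, 0 ≤ C' ∧ ∀ (L k : ℕ) (w : Pt), |F L k w| ≤ C' * Real.exp (-δ * l1 w)) (c : ℝ) :
    ∃ B, Tendsto (psum (fun w : Pt => c * (toReal w μ * toReal w ν * F 0 0 (-w)))) atTop (𝓝 B) := by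
  obtain ⟨C', -, h⟩ := hF
  have hD : Decay510 (fun w : Pt => F 0 0 (-w)) C' δ := fun w => by
    have h1 := h 0 0 (-w)
    rwa [l1_neg'] at h1
  exact exists_tendsto_psum_const_mul c (exists_tendsto_psum_weight_mul (absMoment₂_of_decay510 hδ hD) μ ν)

/-- [folklore] **(CONV) FOR THE LONGITUDINAL HALF AT FIXED `n`** from `|g v| ≤ C e^{−δ|v|₁}`, `δ > 0` (part 1's `exists_envelope_lonW`). -/
theorem conv_lonK (hδ : 0 < δ) (hg : ∀ v, |g v| ≤ C * Real.exp (-δ * l1 v)) :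
    ∃ B, Tendsto (psum (lonK n g cE ωgl μ ν)) atTop (𝓝 B) := by
  have h := conv_of_envelope μ ν hδ (exists_envelope_lonW hδ.le hg μ ν) (ωgl * (cE * cE) * ((n : ℝ) ^ 8)⁻¹ * (-(1 / 2 : ℝ)))
  have e : lonK n g cE ωgl μ ν = fun w : Pt =>
      ωgl * (cE * cE) * ((n : ℝ) ^ 8)⁻¹ * (-(1 / 2 : ℝ)) * (toReal w μ * toReal w ν * lonW (fun _ _ => g) μ ν 0 0 (-w)) := by
    funext w; simp only [lonK]; ring
  rwa [e]

/-- [folklore] **(CONV) FOR THE REMAINDER HALF AT FIXED `n`** from `|g v| ≤ C e^{−δ|v|₁}`, `δ > 0` (part 1's `exists_envelope_remW`). -/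
theorem conv_remK (hδ : 0 < δ) (hg : ∀ v, |g v| ≤ C * Real.exp (-δ * l1 v)) :
    ∃ B, Tendsto (psum (remK n g cE ωgl μ ν)) atTop (𝓝 B) := by
  have h := conv_of_envelope μ ν hδ (exists_envelope_remW hδ.le hg μ ν) (ωgl * (cE * cE) * ((n : ℝ) ^ 8)⁻¹ * (-(1 / 2 : ℝ)))
  have e : remK n g cE ωgl μ ν = fun w : Pt =>
      ωgl * (cE * cE) * ((n : ℝ) ^ 8)⁻¹ * (-(1 / 2 : ℝ)) * (toReal w μ * toReal w ν * remW (fun _ _ => g) μ ν 0 0 (-w)) := by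
    funext w; simp only [remK]; ring
  rwa [e]

/-- [folklore] **(CONV) FOR THE WHOLE crossE WORD AT FIXED `n`** — the `hKr` hypothesis of the owner's `AssemblyEnd.defect_le_at` at `τ = crossE`, from the
profile's exponential bound alone (`restK_crossE = lonK + remK` + the two halves' convergence; `WindowIdentification.exists_tendsto_psum_add`). -/
theorem conv_restK_crossE [NeZero n] (a : ℝ) (cΛ cR cK cQ cE₂ cJ4 cΛ₂ cR₂ cQ₂ x₀ : ℝ) (WE WJ WΛ WR WQ : TableR) (ωgh lam N : ℝ) (b : Pt)
    (hδ : 0 < δ) (hg : ∀ v, |g v| ≤ C * Real.exp (-δ * l1 v)) :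
    ∃ B, Tendsto (psum (restK n a g cE cΛ cR cK cQ cE₂ cJ4 cΛ₂ cR₂ cQ₂ x₀ WE WJ WΛ WR WQ ωgl ωgh lam N μ ν b
      (Sum.inr (Sum.inr (Sum.inr (Sum.inr 1)))))) atTop (𝓝 B) := by
  rw [restK_crossE_eq_lonK_add_remK]
  exact WindowIdentification.exists_tendsto_psum_add (conv_lonK n cE ωgl μ ν hδ hg) (conv_remK n cE ωgl μ ν hδ hg)

end Conv

/-! ## §5 The base-point average and the packaged binders -/

section Average

variable (n : ℕ) [NeZero n] {gb : Pt → Pt → ℝ} (cE ωgl : ℝ) (μ ν : Fin 4) {A : ℝ}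

/-- [folklore] **BASE-POINT AVERAGE AT FIXED `n`** (convex uniform weights on the residue sites): one degree-7 constant `A` for every base site's profile gives
`|Σ_{b ∈ image resSite} n⁻⁴·fullSum (remK n (gb b) cE ω_gl μ ν)| ≤ |ω_gl·(cE·cE)|·n⁻⁸·(80·A)`. -/
theorem abs_avg_fullSum_remK_le (hA : 0 ≤ A)
    (hdec : ∀ b ∈ (univ : Finset (Fin 4 → Fin n)).image resSite, ∀ w : Pt, w ≠ 0 → |remW (fun _ _ => gb b) μ ν 0 0 w| ≤ A / (supNorm w : ℝ) ^ 7) :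
    |∑ b ∈ (univ : Finset (Fin 4 → Fin n)).image resSite, ((n : ℝ) ^ 4)⁻¹ * fullSum (remK n (gb b) cE ωgl μ ν)| ≤
      |ωgl * (cE * cE)| * ((n : ℝ) ^ 8)⁻¹ * (80 * A) :=
  abs_sum_mul_le_of_convex _ (fun b hb => uniform_resSite_nonneg n b hb) (sum_uniform_resSite (NeZero.ne n))
    fun b hb => abs_fullSum_remK_le n cE ωgl μ ν hA (hdec b hb)

end Average

section PackagedBinders

variable {a : ℝ} {gp : ℕ → Pt → Pt → ℝ} {cE ωgl : ℕ → ℝ} {μ ν : Fin 4}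

/-- [folklore] **(CONV) FOR THE LONGITUDINAL HALF, PACKAGED** (from the owner's profile hypothesis `hg` of `SplitPackaged.hsplit_packaged`). -/
theorem hKr_lonK_packaged (hg : ∀ n : ℕ, 2 ≤ n → ∀ b : Pt, ∃ C δ : ℝ, 0 < δ ∧ ∀ v, |gp n b v| ≤ C * Real.exp (-δ * l1 v)) :
    ∀ n : ℕ, 2 ≤ n → ∀ b ∈ (univ : Finset (Fin 4 → Fin n)).image resSite, ∃ B,
      Tendsto (psum (lonK n (gp n b) (cE n) (ωgl n) μ ν)) atTop (𝓝 B) := by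
  intro n hn b _
  obtain ⟨C, δ, hδ, hgb⟩ := hg n hn b
  exact conv_lonK n (cE n) (ωgl n) μ ν hδ hgb

/-- [folklore] **(CONV) FOR THE REMAINDER HALF, PACKAGED** (same input). -/
theorem hKr_remK_packaged (hg : ∀ n : ℕ, 2 ≤ n → ∀ b : Pt, ∃ C δ : ℝ, 0 < δ ∧ ∀ v, |gp n b v| ≤ C * Real.exp (-δ * l1 v)) :
    ∀ n : ℕ, 2 ≤ n → ∀ b ∈ (univ : Finset (Fin 4 → Fin n)).image resSite, ∃ B,
      Tendsto (psum (remK n (gp n b) (cE n) (ωgl n) μ ν)) atTop (𝓝 B) := by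
  intro n hn b _
  obtain ⟨C, δ, hδ, hgb⟩ := hg n hn b
  exact conv_remK n (cE n) (ωgl n) μ ν hδ hgb

/-- [folklore] **THE (REST) BINDER FOR THE REMAINDER HALF OF crossE — A2 CLASS, EVERY BLOCK SIZE, ONE CONSTANT.**  Inputs: a leg FAMILY `G` with an3's
difference budget `DG 3 2 G` (rows d0–d3 uniform in `(L,k)`), and MEMBERSHIP of every frozen profile: `gp n b = G n (e n b)` for `n ≥ 2`, `b ∈ image resSite`
(the base site encoded in the dummy index `k` by any `e : ℕ → Pt → ℕ`, e.g. an enumeration of the residue sites).  Output: ONE `A ≥ 0` with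
`∀ n ≥ 2, |Σ_{b ∈ image resSite} n⁻⁴·fullSum (remK n (gp n b) (cE n) (ω_gl n) μ ν)| ≤ |ω_gl n·(cE n·cE n)|·n⁻⁸·(80·A)`. -/
theorem hR_remK_packaged {G : Fam} (hG : DG 3 2 G) {e : ℕ → Pt → ℕ}
    (hmem : ∀ n : ℕ, 2 ≤ n → ∀ b ∈ (univ : Finset (Fin 4 → Fin n)).image resSite, gp n b = G n (e n b)) :
    ∃ A : ℝ, 0 ≤ A ∧ ∀ n : ℕ, 2 ≤ n →
      |∑ b ∈ (univ : Finset (Fin 4 → Fin n)).image resSite, ((n : ℝ) ^ 4)⁻¹ * fullSum (remK n (gp n b) (cE n) (ωgl n) μ ν)| ≤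
        |ωgl n * (cE n * cE n)| * ((n : ℝ) ^ 8)⁻¹ * (80 * A) := by
  obtain ⟨A, hA, hdec⟩ := exists_decay_remW hG μ ν
  refine ⟨A, hA, fun n hn => ?_⟩
  haveI : NeZero n := ⟨Nat.one_le_iff_ne_zero.mp (le_trans one_le_two hn)⟩
  refine abs_avg_fullSum_remK_le n (cE n) (ωgl n) μ ν hA fun b hb w hw => ?_
  rw [hmem n hn b hb, ← remW_const_apply_eq_zero_idx (G n (e n b)) μ ν n (e n b) w, ← remW_apply_eq_const]
  exact hdec n (e n b) w hw

/-- [folklore] **… AND UNDER THE DISPLAYED WEIGHT INEQUALITY** `|ω_gl n·(cE n·cE n)|·n⁻⁸ ≤ Ω` (slot (K) ∕ CHECK-N0's units — ruled nowhere here):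
`∃ A ≥ 0, ∀ n ≥ 2, |Σ_b n⁻⁴·fullSum (remK …)| ≤ Ω·(80·A)` — the shape of the `hR` binder of `Assembly.abs_defect_le_of_slots` for this half-word. -/
theorem hR_remK_packaged_of_weight {G : Fam} (hG : DG 3 2 G) {e : ℕ → Pt → ℕ}
    (hmem : ∀ n : ℕ, 2 ≤ n → ∀ b ∈ (univ : Finset (Fin 4 → Fin n)).image resSite, gp n b = G n (e n b)) {Ω : ℝ}
    (hΩ : ∀ n : ℕ, 2 ≤ n → |ωgl n * (cE n * cE n)| * ((n : ℝ) ^ 8)⁻¹ ≤ Ω) :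
    ∃ A : ℝ, 0 ≤ A ∧ ∀ n : ℕ, 2 ≤ n →
      |∑ b ∈ (univ : Finset (Fin 4 → Fin n)).image resSite, ((n : ℝ) ^ 4)⁻¹ * fullSum (remK n (gp n b) (cE n) (ωgl n) μ ν)| ≤ Ω * (80 * A) := by
  obtain ⟨A, hA, h⟩ := hR_remK_packaged (cE := cE) (ωgl := ωgl) (μ := μ) (ν := ν) hG hmem
  exact ⟨A, hA, fun n hn => (h n hn).trans (mul_le_mul_of_nonneg_right (hΩ n hn) (by positivity))⟩

end PackagedBinders

end Summit.QuantumFields.BalabanUV.Beta.D1BFx.CrossERest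

end
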